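import Mathlib
import Literature.AlgebraicGeometry.Resolution.PointBlowupFlagStepTyped
import Summits.ResolutionOfSingularities.ResolutionOfSingularities.Theorems.WeightedInvariantLocalWeightedDropWildMonicFlagAssembly
import Summits.ResolutionOfSingularities.ResolutionOfSingularities.Theorems.WeightedInvariantLocalWeightedDropWildMonicFlagTripleBasic

/-!
# `WeightedInvariant.LocalWeightedDrop`, line `hasse-ridge-face-selection`, S3ρ: the DROP SHAPE SPLIT for the flag family — axis
# points, translated points with two lost components, and the reduction of the third point type to an axis point of the sheared parent

Crux item stmt-ResolutionOfSingularities-8899 `LocalWeightedDrop` (route `ResolutionOfSingularities/WeightedInvariant`), engine of the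
door `HypersurfaceCentreConstruction` stmt-ResolutionOfSingularities-19897.  [OURS · L1 W4.3, chain w43, res-type-083 (S3ρ first seat;
ROADMAP item (C9) of `L/res-L1-w43-stub-7/S3RHOD-ROADMAP.md`).  Tuple port of stub-1's `PurePowerFlag.dropStatement_of_split`
(`…WildPurePowerFlagDropSplit`) for the flag family `WildMonic.IsFlagTriple` of res-L1-w43-stub-3 (`…WildMonicFlagTripleDefs`,
p509448) and the generic assembly `…WildMonicFlagAssembly` (p510834).  MAP: S. Perlega, arXiv:2011.14443 Ch. 9 Prop 9.1.4 proof,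
p0105 «Assume that a′ has the affine coordinates (t,0) … If t ≠ 0 and E ≠ V(xy), we can (after possibly swapping x and y) replace
y by y − tx … Thus, we assume from now on that either t = 0 or E = V(xy) holds»; every object is OURS; not a statement of any
manuscript.]

`DropShape (IsFlagTriple d) p` — the last hypothesis of `wildMonicSurfaceReductionWon_of_shapes` besides attainment — follows
(`dropShape_isFlagTriple_of_split`) from `AttainShape (IsFlagTriple d) p` and the two POINT-TYPE statements
* `DropAxisShape d p k` — the AXIS successor `x^{d-j}·T_j = A_j(x, xy)` (`t = 0`; Per17 9.1.4 cases (1), (3), (4) at `t = 0` and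
  Lemma 9.1.2's flags): every valid admissible flag `(o, g, h)` of the child `(shift d T φ', succE 0 E)` (either orientation) is
  dominated by a valid admissible FIRST-ORIENTATION flag `(g₀, h₀)` of the RAW parent `(A, E)` — strictly, or weakly by a parent flag
  with `s = ⊤` (Per17's escape «`s_F = ∞` ⇒ `F` is not maximising», which the split discharges against the parent's maximum);
* `DropKangarooShape d p k` — the TRANSLATED successor `x^{d-j}·T_j = A_j(x, x(t+y))`, `t ≠ 0`, with BOTH letters boundary at the
  parent (both lost at the child; Per17 9.1.4 cases (2), (4) at `t ≠ 0`): every flag triple of the child is below the parent's maximum;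
the third point type — `t ≠ 0` and `V(x₂)` not a boundary letter — being the axis successor of the SHEARED parent
`A ∘ (x₁, x₂ + t x₁)` (`subst_dirChart_eq_step_shift`), same boundary (`V(x₁)` is shear-stable), whose first-orientation flags `(g, h)`
are the flags `(g, t·X + h)` of `A` with literally the same numbers (`flagTuple_shiftCX`, from stub-3's composition law
`flagTuple_flagTuple`).  Also: `exit₃_of_subst` (an exit up to free moves of `A ∘ σ` is one of `A`, `σ` legal).
-/

set_option linter.dupNamespace false -- mandated namespace of this single-conjunct summit

noncomputable section

namespace Summit.ResolutionOfSingularities.ResolutionOfSingularities.Theorems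

open Literature.AlgebraicGeometry.Resolution
open Literature.AlgebraicGeometry.Resolution.HauserPerlega2024 (Triple)

namespace WildMonic

open MvPowerSeries
open PurePowerFlag (swap swapE orient orientE IsN0 IsTangent succE)

variable {k : Type} [Field k] {d : ℕ}

/-! ### The two point-type statements -/

/-- DROP AT AN AXIS POINT for the flag family (Per17 Prop 9.1.4 at `t = 0`, all flag types of the child): along the axis successor
`x^{d-j}·T_j = A_j(x, xy)` of a RAW parent position `A` (boundary `E`) that no free move puts in an exit, re-centred by any `φ'` to a
position `C = shift d T φ'` that no free move puts in an exit, every VALID ADMISSIBLE flag `(o, g, h)` of `(C, succE 0 E)` is dominated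
by a valid admissible FIRST-ORIENTATION flag `(g₀, h₀)` of `(A, E)`: strictly, or weakly by one whose `s`-component is `⊤`. -/
def DropAxisShape (d p : ℕ) (k : Type) [Field k] : Prop :=
  ∀ (A : Fin d → MvPowerSeries (Fin 2) k) (E : Finset (Fin 2)) (T : Fin d → MvPowerSeries (Fin 2) k) (φ' : MvPowerSeries (Fin 2) k),
    IsPos d A → ¬ Exit₃ p d A →
    (∀ j : Fin d, X 0 ^ (d - (j : ℕ)) * T j = subst (PlaneGerm.dirChart (0 : k)) (A j)) →
    constantCoeff φ' = 0 → IsPos d (shift d T φ') → ¬ Exit₃ p d (shift d T φ') →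
    ∀ (o : Bool) (g : MvPowerSeries (Fin 2) k) (h : PowerSeries k), constantCoeff g = 0 → PowerSeries.constantCoeff h = 0 →
      (IsN0 (orientE o (succE (0 : k) E)) h ∨ IsTangent (orientE o (succE (0 : k) E)) h) →
      IsMMax d (orientT o (shift d T φ')) (orientE o (succE (0 : k) E)) g h →
      ∃ (g₀ : MvPowerSeries (Fin 2) k) (h₀ : PowerSeries k), constantCoeff g₀ = 0 ∧ PowerSeries.constantCoeff h₀ = 0 ∧
        (IsN0 E h₀ ∨ IsTangent E h₀) ∧ IsMMax d A E g₀ h₀ ∧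
        flagTriple d (orientT o (shift d T φ')) (orientE o (succE (0 : k) E)) g h ≤ flagTriple d A E g₀ h₀ ∧
        (flagTriple d (orientT o (shift d T φ')) (orientE o (succE (0 : k) E)) g h < flagTriple d A E g₀ h₀ ∨
          (ofLex (ofLex (flagTriple d A E g₀ h₀)).2).2 = ⊤)

/-- DROP AT A TRANSLATED POINT WITH TWO LOST COMPONENTS for the flag family (Per17 Prop 9.1.4 cases (2) and (4) at `t ≠ 0`,
`E = V(x₁x₂)`): along the successor `x^{d-j}·T_j = A_j(x, x(t+y))`, `t ≠ 0`, of a RAW parent position with BOTH letters boundary, given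
the parent's greatest flag triple `vmax` (finite `s`), every flag triple of the re-centred child `(shift d T φ', succE t E = {V(x)})`
that no free move puts in an exit is STRICTLY below `vmax`. -/
def DropKangarooShape (d p : ℕ) (k : Type) [Field k] : Prop :=
  ∀ (A : Fin d → MvPowerSeries (Fin 2) k) (E : Finset (Fin 2)) (t : k) (T : Fin d → MvPowerSeries (Fin 2) k)
    (φ' : MvPowerSeries (Fin 2) k) (vmax : Triple),
    IsPos d A → ¬ Exit₃ p d A → IsFlagTriple d A E vmax → (ofLex (ofLex vmax).2).2 ≠ ⊤ → (∀ u, IsFlagTriple d A E u → u ≤ vmax) →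
    t ≠ 0 → (0 : Fin 2) ∈ E → (1 : Fin 2) ∈ E →
    (∀ j : Fin d, X 0 ^ (d - (j : ℕ)) * T j = subst (PlaneGerm.dirChart t) (A j)) →
    constantCoeff φ' = 0 → IsPos d (shift d T φ') → ¬ Exit₃ p d (shift d T φ') →
    ∀ w, IsFlagTriple d (shift d T φ') (succE t E) w → w < vmax

/-! ### Exits up to free moves are stable under legal plane changes -/

/-- An exit up to free moves of `A ∘ σ` (`σ` a legal plane change) is one of `A`: compose the changes. -/
theorem exit₃_of_subst {p : ℕ} {σ : Fin 2 → MvPowerSeries (Fin 2) k} (hσ0 : ∀ i, constantCoeff (σ i) = 0)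
    (hσdet : IsUnit (FormalCoordChange.linMat σ).det) {A : Fin d → MvPowerSeries (Fin 2) k}
    (h : Exit₃ p d (fun j => subst σ (A j))) : Exit₃ p d A := by
  obtain ⟨θ, φ, hθ0, hθdet, hφ0, hpos, hex⟩ := h
  have hcomp : (fun j => subst θ (subst σ (A j))) = fun j => subst (fun i => subst θ (σ i)) (A j) :=
    funext fun j => subst_subst_eq_subst_comp hσ0 hθ0 (A j)
  refine ⟨fun i => subst θ (σ i), φ, constantCoeff_comp_eq_zero hσ0 hθ0, ?_, hφ0, hcomp ▸ hpos, hcomp ▸ hex⟩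
  rw [linMat_comp σ hθ0, Matrix.det_mul]
  exact hσdet.mul hθdet

/-! ### The sheared parent `A ∘ (x₁, x₂ + t·x₁)` -/

/-- The shear by `t·x` has no constant terms. -/
theorem constantCoeff_shiftCX (t : k) (l : Fin 2) :
    constantCoeff (PurePowerFlag.shift (PowerSeries.C t * PowerSeries.X) l) = 0 :=
  PurePowerFlag.constantCoeff_shift _ (by rw [map_mul, PowerSeries.constantCoeff_X, mul_zero]) l

/-- Positions are preserved by the shear. -/
theorem isPos_shiftCX (t : k) {A : Fin d → MvPowerSeries (Fin 2) k} (hA : IsPos d A) :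
    IsPos d (fun j => subst (PurePowerFlag.shift (PowerSeries.C t * PowerSeries.X)) (A j)) :=
  fun j => lt_of_lt_of_le (hA j) (PurePowerFlag.order_le_order_subst _ (constantCoeff_shiftCX t) (A j))

/-- No exit up to free moves is created by the shear. -/
theorem not_exit₃_shiftCX {p : ℕ} (t : k) {A : Fin d → MvPowerSeries (Fin 2) k} (hA : ¬ Exit₃ p d A) :
    ¬ Exit₃ p d (fun j => subst (PurePowerFlag.shift (PowerSeries.C t * PowerSeries.X)) (A j)) :=
  fun h => hA (exit₃_of_subst (constantCoeff_shiftCX t) (by rw [PurePowerFlag.linMat_shift_det]; exact isUnit_one) h)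

/-- The sheared tuple is the flag tuple of the flag `(0, t·X)`. -/
theorem shiftCX_eq_flagTuple (t : k) (A : Fin d → MvPowerSeries (Fin 2) k) :
    (fun j => subst (PurePowerFlag.shift (PowerSeries.C t * PowerSeries.X)) (A j)) = flagTuple d A 0 (PowerSeries.C t * PowerSeries.X) := by
  rw [flagTuple_def, WildMonic.shift_zero]

/-- FIRST-ORIENTATION FLAGS OF THE SHEARED PARENT ARE FLAGS OF THE PARENT: `flagTuple d (A ∘ shear_t) g h = flagTuple d A g (t·X + h)`. -/
theorem flagTuple_shiftCX (t : k) (A : Fin d → MvPowerSeries (Fin 2) k) (g : MvPowerSeries (Fin 2) k) {h : PowerSeries k}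
    (hh : PowerSeries.constantCoeff h = 0) :
    flagTuple d (fun j => subst (PurePowerFlag.shift (PowerSeries.C t * PowerSeries.X)) (A j)) g h =
      flagTuple d A g (PowerSeries.C t * PowerSeries.X + h) := by
  have h₁0 : PowerSeries.constantCoeff (PowerSeries.C t * PowerSeries.X : PowerSeries k) = 0 := by
    rw [map_mul, PowerSeries.constantCoeff_X, mul_zero]
  have hs : HasSubst (PurePowerFlag.shift h) := PurePowerFlag.hasSubst_shift' h hh
  rw [shiftCX_eq_flagTuple, flagTuple_flagTuple A 0 g h₁0 hh, ← coe_substAlgHom hs, map_zero, zero_add]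

/-- … hence the same `m` (when `V(x₂)` is not a boundary letter, so that every first-orientation flag is an `n = 0` flag), -/
theorem mOf_shiftCX (t : k) (A : Fin d → MvPowerSeries (Fin 2) k) {E : Finset (Fin 2)} (h1 : (1 : Fin 2) ∉ E)
    (g : MvPowerSeries (Fin 2) k) {h : PowerSeries k} (hh : PowerSeries.constantCoeff h = 0) :
    mOf d (fun j => subst (PurePowerFlag.shift (PowerSeries.C t * PowerSeries.X)) (A j)) E g h =
      mOf d A E g (PowerSeries.C t * PowerSeries.X + h) := by
  rw [mOf_of_isN0 (Or.inl h1 : IsN0 E h), mOf_of_isN0 (Or.inl h1 : IsN0 E (PowerSeries.C t * PowerSeries.X + h)),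
    flagTuple_shiftCX t A g hh]

/-- … the same triple, -/
theorem flagTriple_shiftCX (t : k) (A : Fin d → MvPowerSeries (Fin 2) k) {E : Finset (Fin 2)} (h1 : (1 : Fin 2) ∉ E)
    (g : MvPowerSeries (Fin 2) k) {h : PowerSeries k} (hh : PowerSeries.constantCoeff h = 0) :
    flagTriple d (fun j => subst (PurePowerFlag.shift (PowerSeries.C t * PowerSeries.X)) (A j)) E g h =
      flagTriple d A E g (PowerSeries.C t * PowerSeries.X + h) := by
  rw [flagTriple_of_isN0 (Or.inl h1 : IsN0 E h), flagTriple_of_isN0 (Or.inl h1 : IsN0 E (PowerSeries.C t * PowerSeries.X + h)),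
    flagTuple_shiftCX t A g hh]

/-- … and the same validity. -/
theorem isMMax_shiftCX_iff (t : k) (A : Fin d → MvPowerSeries (Fin 2) k) {E : Finset (Fin 2)} (h1 : (1 : Fin 2) ∉ E)
    (g : MvPowerSeries (Fin 2) k) {h : PowerSeries k} (hh : PowerSeries.constantCoeff h = 0) :
    IsMMax d (fun j => subst (PurePowerFlag.shift (PowerSeries.C t * PowerSeries.X)) (A j)) E g h ↔
      IsMMax d A E g (PowerSeries.C t * PowerSeries.X + h) := by
  unfold IsMMax
  simp only [mOf_shiftCX t A h1 _ hh]

/-- THE TRANSLATED SUCCESSOR IS THE AXIS SUCCESSOR OF THE SHEARED PARENT: `A_j(x, x(t+y)) = (A_j ∘ shear_t)(x, xy)`. -/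
theorem axis_successor_of_shiftCX (t : k) {A T : Fin d → MvPowerSeries (Fin 2) k}
    (hT : ∀ j : Fin d, X 0 ^ (d - (j : ℕ)) * T j = subst (PlaneGerm.dirChart t) (A j)) (j : Fin d) :
    X 0 ^ (d - (j : ℕ)) * T j =
      subst (PlaneGerm.dirChart (0 : k)) (subst (PurePowerFlag.shift (PowerSeries.C t * PowerSeries.X)) (A j)) := by
  rw [hT j, HauserPerlega2024.subst_dirChart_eq_step_shift t (A j), HauserPerlega2024.step_eq_dirChart_zero]
  rfl

/-! ### The reduction -/

/-- At a translated point with `V(x₂)` not a boundary letter, no old component survives: `succE t E = succE 0 E = {V(x)}`. -/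
theorem succE_eq_succE_zero {t : k} (ht : t ≠ 0) {E : Finset (Fin 2)} (h1 : (1 : Fin 2) ∉ E) : succE t E = succE (0 : k) E := by
  unfold succE
  rw [if_neg (fun h => ht h.1), if_neg (fun h => h1 h.2)]

/-- **`DropShape (IsFlagTriple d) p` FROM ATTAINMENT AND THE TWO POINT-TYPE STATEMENTS.**  Axis points: `DropAxisShape`, the weak
escape discharged against the parent's maximum (finite `s`).  Translated points with both letters boundary: `DropKangarooShape`.  Translated
points with `V(x₂)` not boundary: `DropAxisShape` for the sheared parent and its axis successor, transporting the dominating flag `(g₀, h₀)`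
to `(g₀, t·X + h₀)`. -/
theorem dropShape_isFlagTriple_of_split {p : ℕ} (hattain : AttainShape (IsFlagTriple d (k := k)) p)
    (h0 : DropAxisShape d p k) (hK : DropKangarooShape d p k) : DropShape (IsFlagTriple d (k := k)) p := by
  classical
  -- the axis step for an arbitrary parent, dominator returned as a first-orientation flag of THAT parent
  have haxis : ∀ (A : Fin d → MvPowerSeries (Fin 2) k) (E : Finset (Fin 2)) (T : Fin d → MvPowerSeries (Fin 2) k)
      (φ' : MvPowerSeries (Fin 2) k), IsPos d A → ¬ Exit₃ p d A →
      (∀ j : Fin d, X 0 ^ (d - (j : ℕ)) * T j = subst (PlaneGerm.dirChart (0 : k)) (A j)) →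
      constantCoeff φ' = 0 → IsPos d (shift d T φ') → ¬ Exit₃ p d (shift d T φ') →
      ∀ w, IsFlagTriple d (shift d T φ') (succE (0 : k) E) w →
        ∃ (g₀ : MvPowerSeries (Fin 2) k) (h₀ : PowerSeries k), constantCoeff g₀ = 0 ∧ PowerSeries.constantCoeff h₀ = 0 ∧
          (IsN0 E h₀ ∨ IsTangent E h₀) ∧ IsMMax d A E g₀ h₀ ∧ w ≤ flagTriple d A E g₀ h₀ ∧
          (w < flagTriple d A E g₀ h₀ ∨ (ofLex (ofLex (flagTriple d A E g₀ h₀)).2).2 = ⊤) := by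
    intro A E T φ' hA hex hT hφ' hpos' hex' w hw
    obtain ⟨o, g, h, hg, hh, hadm, hmm, rfl⟩ := hw
    exact h0 A E T φ' hA hex hT hφ' hpos' hex' o g h hg hh hadm hmm
  -- from a weak/strict first-orientation dominator to a strict dominator, against the maximum of the SAME parent
  have hfinish : ∀ (A : Fin d → MvPowerSeries (Fin 2) k) (E : Finset (Fin 2)) (w v₀ : Triple),
      IsPos d A → ¬ Exit₃ p d A → IsFlagTriple d A E v₀ → w ≤ v₀ → (w < v₀ ∨ (ofLex (ofLex v₀).2).2 = ⊤) →
      ∃ v, IsFlagTriple d A E v ∧ w < v := by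
    intro A E w v₀ hA hex hv₀ hle hor
    rcases hor with hlt | htop
    · exact ⟨v₀, hv₀, hlt⟩
    · obtain ⟨vmax, hvmax, hs, hge⟩ := hattain A E hA hex
      have hne : v₀ ≠ vmax := fun h => hs (h ▸ htop)
      exact ⟨vmax, hvmax, lt_of_le_of_lt hle (lt_of_le_of_ne (hge v₀ hv₀) hne)⟩
  intro A E t T φ' hA hex hE hT hφ' hpos' hex' w hw
  by_cases ht : t = 0
  · subst ht
    obtain ⟨g₀, h₀, hg₀, hh₀, hadm₀, hmm₀, hle, hor⟩ := haxis A E T φ' hA hex hT hφ' hpos' hex' w hw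
    exact hfinish A E w _ hA hex (isFlagTriple_of_first hg₀ hh₀ hadm₀ hmm₀) hle hor
  · by_cases h1 : (1 : Fin 2) ∈ E
    · obtain ⟨vmax, hvmax, hs, hge⟩ := hattain A E hA hex
      exact ⟨vmax, hvmax, hK A E t T φ' vmax hA hex hvmax hs hge ht (hE ht h1) h1 hT hφ' hpos' hex' w hw⟩
    · -- `V(x₂)` not a boundary letter: the sheared parent
      set At : Fin d → MvPowerSeries (Fin 2) k := fun j => subst (PurePowerFlag.shift (PowerSeries.C t * PowerSeries.X)) (A j)
        with hAt
      rw [succE_eq_succE_zero ht h1] at hw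
      obtain ⟨g₀, h₀, hg₀, hh₀, -, hmm₀, hle, hor⟩ := haxis At E T φ' (isPos_shiftCX t hA) (not_exit₃_shiftCX t hex)
        (axis_successor_of_shiftCX t hT) hφ' hpos' hex' w hw
      rw [hAt, flagTriple_shiftCX t A h1 g₀ hh₀] at hle hor
      rw [hAt, isMMax_shiftCX_iff t A h1 g₀ hh₀] at hmm₀
      have hh₁ : PowerSeries.constantCoeff (PowerSeries.C t * PowerSeries.X + h₀) = 0 := by
        rw [map_add, map_mul, PowerSeries.constantCoeff_X, mul_zero, zero_add, hh₀]
      exact hfinish A E w _ hA hex (isFlagTriple_of_first hg₀ hh₁ (Or.inl (Or.inl h1)) hmm₀) hle hor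

end WildMonic

end Summit.ResolutionOfSingularities.ResolutionOfSingularities.Theorems

end
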